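import Literature.NumberTheory.EllipticCurves.PAdicLFunctionMuInvariantCertificateProofs
import Literature.NumberTheory.EllipticCurves.KubotaLeopoldtTwoNumerator
import Summits.BirchSwinnertonDyer.BirchSwinnertonDyer.Theorems.AlignedTransportAtTwoMainConjectureTransportAlignedAtTwoSymbolParity
import HarnessLib

/-!
# Route `AlignedTransportAtTwo`, crux C1 `MainConjectureTransportAlignedAtTwo` (stmt-BirchSwinnertonDyer-22296), line `birth` —
# WHAT THE CRUX'S `μ`-HYPOTHESIS IS at `p = 2`: `μ = 0` / `μ > 0` CERTIFICATES from the Mazur–Swinnerton-Dyer measure on the classes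
# `5ˢ mod 2^{n+2}` (Mazur–Tate–Teitelbaum §I.11–I.13 at `p = 2`, via the `Γ`-half distribution; kernel-checked)

HONEST FRAMING (cell `bsd-f1-sign2`, lead seat `bsd-line-att-p1` g3). BSD is NOT proved here and C1 is NOT closed here. The crux carries
`μ^an(W₁) = 0` in the tree's normalisation — `red G₁ ≠ 0` for the integral lift of the `Δ = {±1}`-DOUBLED Mazur–Tate–Teitelbaum transform —
and the censuses read «`μ = 0`» off modular-symbol tables. At `p = 2` the tree's unit-content certificate
(`exists_lt_norm_limUnder_riemannSum_of_lt_norm_orbitSum`, bound `C` of the measure) is VACUOUS as it stands: the Teichmüller-orbit sums are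
`2μ(5ˢ)`, of norm `≤ 1 = C·2⁻¹` for the `½ℤ₂`-valued measure. One certifies with the `Γ`-HALF `ν` of the even distribution `μ` (§1: `ν = μ`
on the classes `≡ 1 (mod 4)`, `0` on those `≡ 3 (mod 4)`, patched at levels `0, 1`; a distribution bounded by `C` with `RS_μ = 2·RS_ν`,
`L_μ = 2·L_ν`). §2: ONE value `μ(5^{s₀} + 2^{n+2}ℤ₂)` of norm `> C/2` forces a coefficient of `L_μ` of norm `> C/4`; for a good-ordinary curve
with `E[2]` irreducible (`C = 2`): one HALF-ODD value `μ_{f,α}(5^{s₀} + 2^{n+2}ℤ₂) = α^{−(n+2)}[5^{s₀}/2^{n+2}]⁺ − α^{−(n+3)}[5^{s₀}/2^{n+1}]⁺`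
⇒ `red G ≠ 0` (`red_ne_zero_of_half_odd_msdMeasure`). §3: values congruent to one another modulo `C/2` at every level ⇒ all coefficients
of norm `≤ C/4`; curve form: all `μ_{f,α}(5ˢ) − μ_{f,α}(5^{s'}) ∈ ℤ₂` ⇒ `red G = 0` (`red_eq_zero_of_msdMeasure_congr`). So a census
«`μ = 0`» row is a kernel display of the crux's hypothesis from ONE exact half-odd value. Everything is proved; nothing about any curve is
asserted. `--supports stmt-BirchSwinnertonDyer-22296`; closes nothing.

References: [MazurTateTeitelbaum1986Invent] §I.10 (10.1), §I.11–I.13 (p = 2: Δ = {±1}, γ = 5); [GreenbergVatsal2000] (2)–(3), Prop. 3.7;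
[SteinWuthrich2013] §3.
-/

set_option autoImplicit false
set_option linter.dupNamespace false

noncomputable section

open scoped Classical MatrixGroups ModularForm

open CongruenceSubgroup Filter Topology WeierstrassCurve
open Literature.NumberTheory.EllipticCurves Literature.NumberTheory.EllipticCurves.ModularForms
open Literature.NumberTheory.EllipticCurves.Greenberg1999
open Summit.BirchSwinnertonDyer.Rank1Residual.X1.MuLambda
open Summit.BirchSwinnertonDyer.Rank1Residual.F1Sign2
open Summit.BirchSwinnertonDyer.BirchSwinnertonDyer.Theorems.AlignedTransportAtTwoSigmaGlue
open Summit.BirchSwinnertonDyer.BirchSwinnertonDyer.Theorems.AlignedTransportAtTwoSymbolParity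

namespace Summit.BirchSwinnertonDyer.BirchSwinnertonDyer.Theorems.AlignedTransportAtTwoMuCertificate

/-! ## §1 The `Γ`-half of an even distribution on `ℤ₂` -/

section Half

variable {μ ν : (n : ℕ) → ZMod (2 ^ n) → ℚ_[2]}

/-- The roots of unity of order dividing `2` in `ℤ₂` are `±1`. [folklore] -/
theorem coe_rootsOfUnity_two_eq_or' (ξ : rootsOfUnity 2 ℤ_[2]) :
    ((ξ : ℤ_[2]ˣ) : ℤ_[2]) = 1 ∨ ((ξ : ℤ_[2]ˣ) : ℤ_[2]) = -1 := by
  have h := ξ.2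
  rw [mem_rootsOfUnity] at h
  exact sq_eq_one_iff.mp (by rw [← Units.val_pow_eq_pow_val, h, Units.val_one])

/-- `∑_ξ G(ξ) = G(1) + G(−1)` over the Teichmüller set `{±1}` of `ℤ₂`. [folklore] -/
theorem finsum_rootsOfUnity_two (G : ℤ_[2] → ℚ_[2]) :
    ∑ᶠ ξ : rootsOfUnity (torsionOrder 2) ℤ_[2], G ((ξ : ℤ_[2]ˣ) : ℤ_[2]) = G 1 + G (-1) := by
  have hζmem : (-1 : ℤ_[2]ˣ) ∈ rootsOfUnity 2 ℤ_[2] := by rw [mem_rootsOfUnity]; norm_num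
  set ζ : rootsOfUnity 2 ℤ_[2] := ⟨-1, hζmem⟩ with hζ
  have hne : (1 : rootsOfUnity 2 ℤ_[2]) ≠ ζ := by
    intro h
    have h' : (((1 : rootsOfUnity 2 ℤ_[2]) : ℤ_[2]ˣ) : ℤ_[2]) = ((ζ : ℤ_[2]ˣ) : ℤ_[2]) := by rw [h]
    rw [hζ] at h'
    simp only [OneMemClass.coe_one, Units.val_one, Units.val_neg] at h'
    exact two_ne_zero (by linear_combination h' : (2 : ℤ_[2]) = 0)
  haveI : Fintype (rootsOfUnity 2 ℤ_[2]) := Fintype.ofFinite _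
  have huniv : (Finset.univ : Finset (rootsOfUnity 2 ℤ_[2])) = {1, ζ} := by
    ext ξ
    simp only [Finset.mem_univ, Finset.mem_insert, Finset.mem_singleton, true_iff]
    rcases coe_rootsOfUnity_two_eq_or' ξ with h | h
    · left; exact Subtype.ext (Units.ext (by simpa using h))
    · right; exact Subtype.ext (Units.ext (by rw [hζ]; simpa using h))
  have hθ : (∑ᶠ ξ : rootsOfUnity (torsionOrder 2) ℤ_[2], G ((ξ : ℤ_[2]ˣ) : ℤ_[2])) =
      ∑ᶠ ξ : rootsOfUnity 2 ℤ_[2], G ((ξ : ℤ_[2]ˣ) : ℤ_[2]) := by rw [torsionOrder_two]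
  rw [hθ, finsum_eq_sum_of_fintype, huniv, Finset.sum_pair hne]
  simp only [OneMemClass.coe_one, Units.val_one, hζ, Units.val_neg]

/-- The class `5ˢ mod 2^{n+2}` is `≡ 1 (mod 4)`. [folklore] -/
theorem val_cyclotomicGenerator_pow_mod_four (n s : ℕ) :
    (((cyclotomicGenerator 2 : ℕ) : ZMod (2 ^ (n + 2))) ^ s).val % 4 = 1 := by
  haveI : NeZero (2 ^ (n + 2)) := ⟨pow_ne_zero _ two_ne_zero⟩
  rw [← Nat.cast_pow, ZMod.val_natCast, Nat.mod_mod_of_dvd _ (Dvd.intro_left _ (by ring : 2 ^ n * 4 = 2 ^ (n + 2))),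
    cyclotomicGenerator_two, Nat.pow_mod]
  norm_num

/-- The class `−5ˢ mod 2^{n+2}` is `≡ 3 (mod 4)`. [folklore] -/
theorem val_neg_cyclotomicGenerator_pow_mod_four (n s : ℕ) :
    (-(((cyclotomicGenerator 2 : ℕ) : ZMod (2 ^ (n + 2))) ^ s)).val % 4 = 3 := by
  haveI : NeZero (2 ^ (n + 2)) := ⟨pow_ne_zero _ two_ne_zero⟩
  have h1 := val_cyclotomicGenerator_pow_mod_four n s
  set x : ZMod (2 ^ (n + 2)) := ((cyclotomicGenerator 2 : ℕ) : ZMod (2 ^ (n + 2))) ^ s with hx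
  have hx0 : x ≠ 0 := by intro h0; rw [h0, ZMod.val_zero, Nat.zero_mod] at h1; exact zero_ne_one h1
  rw [ZMod.neg_val, if_neg hx0]
  have hlt : x.val < 2 ^ (n + 2) := ZMod.val_lt x
  obtain ⟨q, hq⟩ : 4 ∣ 2 ^ (n + 2) := Dvd.intro_left _ (by ring : 2 ^ n * 4 = 2 ^ (n + 2))
  omega

/-- **The `Γ`-half `ν` of an even `μ` has `RS_μ(k, n) = 2 · RS_ν(k, n)`** (`hν`: at levels `≥ 2`, `ν = μ` on the classes `≡ 1 (mod 4)`,
`0` on those `≡ 3 (mod 4)`; the Teichmüller set at `2` is `{±1}`, `−5ˢ ≡ 3 (mod 4)`). [cite: MazurTateTeitelbaum1986Invent, §I.13] -/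
theorem distributionRiemannSum_eq_two_mul_half
    (hν : ∀ (n : ℕ) (a : ZMod (2 ^ (n + 2))), ν (n + 2) a = if a.val % 4 = 1 then μ (n + 2) a else 0)
    (heven : ∀ (n : ℕ) (a : ZMod (2 ^ n)), μ n (-a) = μ n a) (k n : ℕ) :
    distributionRiemannSum μ k n = 2 * distributionRiemannSum ν k n := by
  rw [distributionRiemannSum_two_of_even heven k n]
  congr 1
  -- the Riemann sum of `ν`: only the `ξ = 1` fibre survives
  set G : ℤ_[2] → ℚ_[2] := fun x ↦ ∑ s : ZMod (2 ^ n),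
      ν (n + 2) (PadicInt.toZModPow (n + 2) x * (cyclotomicGenerator 2 : ZMod (2 ^ (n + 2))) ^ s.val) *
        ((s.val.choose k : ℕ) : ℚ_[2]) with hG
  have hG1 : G 1 = ∑ s : ZMod (2 ^ n), μ (n + 2) ((cyclotomicGenerator 2 : ZMod (2 ^ (n + 2))) ^ s.val) *
      ((s.val.choose k : ℕ) : ℚ_[2]) := by
    simp only [hG, map_one, one_mul]
    refine Finset.sum_congr rfl fun s _ ↦ ?_
    rw [hν, if_pos (val_cyclotomicGenerator_pow_mod_four n s.val)]
  have hGneg : G (-1) = 0 := by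
    simp only [hG, map_neg, map_one, neg_one_mul]
    refine Finset.sum_eq_zero fun s _ ↦ ?_
    rw [hν, if_neg (by rw [val_neg_cyclotomicGenerator_pow_mod_four n s.val]; decide), zero_mul]
  rw [show distributionRiemannSum ν k n = ∑ᶠ ξ : rootsOfUnity (torsionOrder 2) ℤ_[2], G ((ξ : ℤ_[2]ˣ) : ℤ_[2]) from rfl,
    finsum_rootsOfUnity_two, hGneg, hG1, add_zero]

/-- **The `Γ`-half satisfies the distribution relation** when `μ` does, given its patch at levels `0, 1`:
`ν(1, a) = [a = 1]·μ(1 + 4ℤ₂)`, `ν(0, ·) = μ(1 + 4ℤ₂)`. [cite: MazurTateTeitelbaum1986Invent, §I.11] -/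
theorem half_distribution
    (hν : ∀ (n : ℕ) (a : ZMod (2 ^ (n + 2))), ν (n + 2) a = if a.val % 4 = 1 then μ (n + 2) a else 0)
    (hν1 : ∀ a : ZMod (2 ^ 1), ν 1 a = if a.val = 1 then μ 2 1 else 0)
    (hν0 : ∀ a : ZMod (2 ^ 0), ν 0 a = μ 2 1)
    (hdist : ∀ (n : ℕ) (a : ZMod (2 ^ n)),
      ∑ b ∈ Finset.univ.filter (fun b : ZMod (2 ^ (n + 1)) ↦
        ZMod.castHom (pow_dvd_pow 2 n.le_succ) (ZMod (2 ^ n)) b = a), μ (n + 1) b = μ n a) :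
    ∀ (n : ℕ) (a : ZMod (2 ^ n)),
      ∑ b ∈ Finset.univ.filter (fun b : ZMod (2 ^ (n + 1)) ↦
        ZMod.castHom (pow_dvd_pow 2 n.le_succ) (ZMod (2 ^ n)) b = a), ν (n + 1) b = ν n a := by
  intro n a
  match n, a with
  | 0, a =>
    -- level 0 → 1: `ν(1,0) + ν(1,1) = μ(2,1)`
    haveI : Subsingleton (ZMod (2 ^ 0)) := (ZMod.subsingleton_iff).mpr (pow_zero 2)
    rw [hν0]
    have huniv : (Finset.univ.filter (fun b : ZMod (2 ^ (0 + 1)) ↦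
        ZMod.castHom (pow_dvd_pow 2 (Nat.le_succ 0)) (ZMod (2 ^ 0)) b = a)) = Finset.univ :=
      Finset.filter_true_of_mem fun b _ ↦ Subsingleton.elim _ _
    rw [huniv]
    have h2 : (Finset.univ : Finset (ZMod (2 ^ (0 + 1)))) = {0, 1} := by decide
    have h01 : (0 : ZMod (2 ^ (0 + 1))) ≠ 1 := by decide
    have hv0 : ¬ ((0 : ZMod (2 ^ 1)).val = 1) := by decide
    have hv1 : (1 : ZMod (2 ^ 1)).val = 1 := by decide
    rw [h2, Finset.sum_pair h01, hν1, hν1, if_neg hv0, if_pos hv1, zero_add]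
  | 1, a =>
    -- level 1 → 2: in the fibre of `a` only the class `1 mod 4` carries mass
    haveI : Fact (1 < 2 ^ (1 + 1)) := ⟨by norm_num⟩
    haveI : Fact (1 < 2 ^ 1) := ⟨by norm_num⟩
    have key : ∀ b : ZMod (2 ^ (1 + 1)), ν (1 + 1) b = if b = 1 then μ 2 1 else 0 := by
      intro b
      rw [show ν (1 + 1) b = ν (0 + 2) b from rfl, hν 0 b]
      by_cases hb : b = 1
      · subst hb
        have h1 : (1 : ZMod (2 ^ (0 + 2))).val % 4 = 1 := by decide
        rw [if_pos h1, if_pos rfl]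
      · have h1 : ¬ (b.val % 4 = 1) := by
          intro h
          apply hb
          have hlt : b.val < 4 := by have := ZMod.val_lt b; simpa using this
          rw [Nat.mod_eq_of_lt hlt] at h
          exact ZMod.val_injective _ (by rw [h, ZMod.val_one])
        rw [if_neg h1, if_neg hb]
    simp_rw [key]
    rw [Finset.sum_ite_eq', hν1 a]
    have hmem : (1 : ZMod (2 ^ (1 + 1))) ∈ Finset.univ.filter (fun b : ZMod (2 ^ (1 + 1)) ↦
        ZMod.castHom (pow_dvd_pow 2 (Nat.le_succ 1)) (ZMod (2 ^ 1)) b = a) ↔ (1 : ZMod (2 ^ 1)) = a := by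
      rw [Finset.mem_filter, map_one]; simp
    by_cases ha : a = 1
    · subst ha
      have hv1 : (1 : ZMod (2 ^ 1)).val = 1 := by decide
      rw [if_pos (hmem.mpr rfl), if_pos hv1]
    · have hva : ¬ (a.val = 1) := fun h ↦ ha (ZMod.val_injective _ (by rw [h, ZMod.val_one]))
      rw [if_neg (fun h ↦ ha (hmem.mp h).symm), if_neg hva]
  | k + 2, a =>
    -- levels ≥ 2: the residue mod 4 is constant along the fibre
    haveI : NeZero (2 ^ (k + 2)) := ⟨pow_ne_zero _ two_ne_zero⟩
    haveI : NeZero (2 ^ (k + 2 + 1)) := ⟨pow_ne_zero _ two_ne_zero⟩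
    have hfib : ∀ b : ZMod (2 ^ (k + 2 + 1)), ZMod.castHom (pow_dvd_pow 2 (k + 2).le_succ) (ZMod (2 ^ (k + 2))) b = a →
        b.val % 4 = a.val % 4 := by
      intro b hb
      rw [← hb, ZMod.castHom_apply, ZMod.cast_eq_val, ZMod.val_natCast,
        Nat.mod_mod_of_dvd _ (Dvd.intro_left _ (by ring : 2 ^ k * 4 = 2 ^ (k + 2)))]
    rw [show ν (k + 2) a = if a.val % 4 = 1 then μ (k + 2) a else 0 from hν k a]
    have hrw : ∀ b ∈ Finset.univ.filter (fun b : ZMod (2 ^ (k + 2 + 1)) ↦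
        ZMod.castHom (pow_dvd_pow 2 (k + 2).le_succ) (ZMod (2 ^ (k + 2))) b = a),
        ν (k + 2 + 1) b = if a.val % 4 = 1 then μ (k + 2 + 1) b else 0 := by
      intro b hb
      rw [Finset.mem_filter] at hb
      rw [show ν (k + 2 + 1) b = ν ((k + 1) + 2) b from rfl, hν (k + 1) b, hfib b hb.2]
    rw [Finset.sum_congr rfl hrw]
    split_ifs with h
    · exact hdist (k + 2) a
    · exact Finset.sum_const_zero

/-- The `Γ`-half is bounded by the bound of `μ`. [folklore] -/
theorem norm_half_le
    (hν : ∀ (n : ℕ) (a : ZMod (2 ^ (n + 2))), ν (n + 2) a = if a.val % 4 = 1 then μ (n + 2) a else 0)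
    (hν1 : ∀ a : ZMod (2 ^ 1), ν 1 a = if a.val = 1 then μ 2 1 else 0)
    (hν0 : ∀ a : ZMod (2 ^ 0), ν 0 a = μ 2 1)
    {C : ℝ} (hC : ∀ (n : ℕ) (a : ZMod (2 ^ n)), ‖μ n a‖ ≤ C) :
    ∀ (n : ℕ) (a : ZMod (2 ^ n)), ‖ν n a‖ ≤ C := by
  have hC0 : 0 ≤ C := (norm_nonneg _).trans (hC 0 0)
  intro n a
  match n, a with
  | 0, a => rw [hν0]; exact hC _ _
  | 1, a => rw [hν1]; split_ifs <;> [exact hC _ _; simpa using hC0]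
  | k + 2, a => rw [hν k a]; split_ifs <;> [exact hC _ _; simpa using hC0]

/-- The orbit sum of the `Γ`-half at the class `5ˢ` is the single value `μ(5ˢ + 2^{n+2}ℤ₂)`. [cite: MazurTateTeitelbaum1986Invent, §I.13] -/
theorem orbitSum_half_eq
    (hν : ∀ (n : ℕ) (a : ZMod (2 ^ (n + 2))), ν (n + 2) a = if a.val % 4 = 1 then μ (n + 2) a else 0)
    (n : ℕ) (s : ZMod (2 ^ n)) :
    (∑ᶠ ξ : rootsOfUnity (torsionOrder 2) ℤ_[2],
        ν (n + cyclotomicExponent 2)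
          (PadicInt.toZModPow (n + cyclotomicExponent 2) ((ξ : ℤ_[2]ˣ) : ℤ_[2]) *
            (cyclotomicGenerator 2 : ZMod (2 ^ (n + cyclotomicExponent 2))) ^ s.val)) =
      μ (n + 2) ((cyclotomicGenerator 2 : ZMod (2 ^ (n + 2))) ^ s.val) := by
  set G : ℤ_[2] → ℚ_[2] := fun x ↦
      ν (n + 2) (PadicInt.toZModPow (n + 2) x * (cyclotomicGenerator 2 : ZMod (2 ^ (n + 2))) ^ s.val) with hG
  have hG1 : G 1 = μ (n + 2) ((cyclotomicGenerator 2 : ZMod (2 ^ (n + 2))) ^ s.val) := by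
    simp only [hG, map_one, one_mul]
    rw [hν, if_pos (val_cyclotomicGenerator_pow_mod_four n s.val)]
  have hGneg : G (-1) = 0 := by
    simp only [hG, map_neg, map_one, neg_one_mul]
    rw [hν, if_neg (by rw [val_neg_cyclotomicGenerator_pow_mod_four n s.val]; decide)]
  have hθ : (∑ᶠ ξ : rootsOfUnity (torsionOrder 2) ℤ_[2],
        ν (n + cyclotomicExponent 2)
          (PadicInt.toZModPow (n + cyclotomicExponent 2) ((ξ : ℤ_[2]ˣ) : ℤ_[2]) *
            (cyclotomicGenerator 2 : ZMod (2 ^ (n + cyclotomicExponent 2))) ^ s.val)) =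
      ∑ᶠ ξ : rootsOfUnity (torsionOrder 2) ℤ_[2], G ((ξ : ℤ_[2]ˣ) : ℤ_[2]) := rfl
  rw [hθ, finsum_rootsOfUnity_two, hGneg, hG1, add_zero]

end Half

/-! ## §2–§3 The `μ = 0` and `μ > 0` certificates at `2` for an even distribution -/

section Abstract

variable {μ : (n : ℕ) → ZMod (2 ^ n) → ℚ_[2]}

/-- **`μ = 0` certificate at `p = 2` (even distribution).** Let `μ` be an even distribution on `ℤ₂` with the distribution relation, bounded by
`C`. If ONE value on a class of `Γ = 1 + 4ℤ₂` beats half the bound, `C·2⁻¹ < ‖μ(5^{s₀} + 2^{n+2}ℤ₂)‖`, then some coefficient of the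
transform satisfies `C·2⁻¹ < ‖2⁻¹ · [Tᵏ]L_μ‖`, i.e. `‖[Tᵏ]L_μ‖ > C/4`, with `k < 2ⁿ`. (The tree's general certificate applied to the
`Γ`-half of `μ`, whose transform is `½ L_μ`.) [cite: MazurTateTeitelbaum1986Invent, §I.11–I.13] [cite: GreenbergVatsal2000, p. 2 (2)–(3)] -/
theorem exists_lt_norm_coeff_of_lt_norm_apply_two
    (heven : ∀ (n : ℕ) (a : ZMod (2 ^ n)), μ n (-a) = μ n a)
    (hdist : ∀ (n : ℕ) (a : ZMod (2 ^ n)),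
      ∑ b ∈ Finset.univ.filter (fun b : ZMod (2 ^ (n + 1)) ↦
        ZMod.castHom (pow_dvd_pow 2 n.le_succ) (ZMod (2 ^ n)) b = a), μ (n + 1) b = μ n a)
    {C : ℝ} (hC : ∀ (n : ℕ) (a : ZMod (2 ^ n)), ‖μ n a‖ ≤ C) {n : ℕ} {s₀ : ZMod (2 ^ n)}
    (hs₀ : C * (2 : ℝ)⁻¹ < ‖μ (n + 2) ((cyclotomicGenerator 2 : ZMod (2 ^ (n + 2))) ^ s₀.val)‖) :
    ∃ k < 2 ^ n, C * (2 : ℝ)⁻¹ < ‖(2 : ℚ_[2])⁻¹ * PowerSeries.coeff k (distributionTransform μ)‖ := by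
  -- the `Γ`-half
  let ν : (m : ℕ) → ZMod (2 ^ m) → ℚ_[2] := fun m ↦
    match m with
    | 0 => fun _ ↦ μ 2 1
    | 1 => fun a ↦ if a.val = 1 then μ 2 1 else 0
    | k + 2 => fun a ↦ if a.val % 4 = 1 then μ (k + 2) a else 0
  have hν : ∀ (m : ℕ) (a : ZMod (2 ^ (m + 2))), ν (m + 2) a = if a.val % 4 = 1 then μ (m + 2) a else 0 := fun _ _ ↦ rfl
  have hν1 : ∀ a : ZMod (2 ^ 1), ν 1 a = if a.val = 1 then μ 2 1 else 0 := fun _ ↦ rfl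
  have hν0 : ∀ a : ZMod (2 ^ 0), ν 0 a = μ 2 1 := fun _ ↦ rfl
  have hdν := half_distribution hν hν1 hν0 hdist
  have hbν := norm_half_le hν hν1 hν0 hC
  -- the tree's certificate for `ν`
  have hs₀' : C * ((2 : ℕ) : ℝ)⁻¹ < ‖∑ᶠ ξ : rootsOfUnity (torsionOrder 2) ℤ_[2],
      ν (n + cyclotomicExponent 2)
        (PadicInt.toZModPow (n + cyclotomicExponent 2) ((ξ : ℤ_[2]ˣ) : ℤ_[2]) *
          (cyclotomicGenerator 2 : ZMod (2 ^ (n + cyclotomicExponent 2))) ^ s₀.val)‖ := by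
    rw [orbitSum_half_eq hν n s₀]; exact_mod_cast hs₀
  obtain ⟨k, hk, hlt⟩ := exists_lt_norm_limUnder_riemannSum_of_lt_norm_orbitSum (distributionRiemannSum_spec ν) hdν hbν hs₀'
  refine ⟨k, hk, ?_⟩
  -- `[Tᵏ]L_μ = 2 · [Tᵏ]L_ν`
  have h2 : PowerSeries.coeff k (distributionTransform μ) = 2 * PowerSeries.coeff k (distributionTransform ν) := by
    rw [coeff_distributionTransform, coeff_distributionTransform]
    have ht := (tendsto_distributionRiemannSum hdν hbν k).const_mul (2 : ℚ_[2])
    rw [coeff_distributionTransform] at ht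
    have hfun : (fun m ↦ 2 * distributionRiemannSum ν k m) = distributionRiemannSum μ k :=
      funext fun m ↦ (distributionRiemannSum_eq_two_mul_half hν heven k m).symm
    rw [hfun] at ht
    exact ht.limUnder_eq
  rw [h2, ← mul_assoc, inv_mul_cancel₀ two_ne_zero, one_mul, coeff_distributionTransform]
  exact_mod_cast hlt

/-- **`μ > 0` certificate at `p = 2` (even distribution).** If at every level the values on the classes of `Γ` are congruent to one
another modulo the ball `C·2⁻¹` — `‖μ(5ˢ + 2^{n+2}ℤ₂) − μ(5^{s'} + 2^{n+2}ℤ₂)‖ ≤ C·2⁻¹` for all `n, s, s'` — then every coefficient of the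
transform satisfies `‖2⁻¹·[Tᵏ]L_μ‖ ≤ C·2⁻¹`, i.e. `‖[Tᵏ]L_μ‖ ≤ C/4`. [cite: MazurTateTeitelbaum1986Invent, §I.11–I.13] -/
theorem norm_coeff_le_of_forall_norm_sub_le_two
    (heven : ∀ (n : ℕ) (a : ZMod (2 ^ n)), μ n (-a) = μ n a)
    (hdist : ∀ (n : ℕ) (a : ZMod (2 ^ n)),
      ∑ b ∈ Finset.univ.filter (fun b : ZMod (2 ^ (n + 1)) ↦
        ZMod.castHom (pow_dvd_pow 2 n.le_succ) (ZMod (2 ^ n)) b = a), μ (n + 1) b = μ n a)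
    {C : ℝ} (hC : ∀ (n : ℕ) (a : ZMod (2 ^ n)), ‖μ n a‖ ≤ C)
    (hcongr : ∀ (n : ℕ) (s s' : ZMod (2 ^ n)),
      ‖μ (n + 2) ((cyclotomicGenerator 2 : ZMod (2 ^ (n + 2))) ^ s.val) -
          μ (n + 2) ((cyclotomicGenerator 2 : ZMod (2 ^ (n + 2))) ^ s'.val)‖ ≤ C * (2 : ℝ)⁻¹) (k : ℕ) :
    ‖(2 : ℚ_[2])⁻¹ * PowerSeries.coeff k (distributionTransform μ)‖ ≤ C * (2 : ℝ)⁻¹ := by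
  let ν : (m : ℕ) → ZMod (2 ^ m) → ℚ_[2] := fun m ↦
    match m with
    | 0 => fun _ ↦ μ 2 1
    | 1 => fun a ↦ if a.val = 1 then μ 2 1 else 0
    | k + 2 => fun a ↦ if a.val % 4 = 1 then μ (k + 2) a else 0
  have hν : ∀ (m : ℕ) (a : ZMod (2 ^ (m + 2))), ν (m + 2) a = if a.val % 4 = 1 then μ (m + 2) a else 0 := fun _ _ ↦ rfl
  have hν1 : ∀ a : ZMod (2 ^ 1), ν 1 a = if a.val = 1 then μ 2 1 else 0 := fun _ ↦ rfl
  have hν0 : ∀ a : ZMod (2 ^ 0), ν 0 a = μ 2 1 := fun _ ↦ rfl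
  have hdν := half_distribution hν hν1 hν0 hdist
  have hbν := norm_half_le hν hν1 hν0 hC
  have hcongr' : ∀ (n : ℕ) (s s' : ZMod (2 ^ n)),
      ‖(∑ᶠ ξ : rootsOfUnity (torsionOrder 2) ℤ_[2],
          ν (n + cyclotomicExponent 2)
            (PadicInt.toZModPow (n + cyclotomicExponent 2) ((ξ : ℤ_[2]ˣ) : ℤ_[2]) *
              (cyclotomicGenerator 2 : ZMod (2 ^ (n + cyclotomicExponent 2))) ^ s.val)) -
        (∑ᶠ ξ : rootsOfUnity (torsionOrder 2) ℤ_[2],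
          ν (n + cyclotomicExponent 2)
            (PadicInt.toZModPow (n + cyclotomicExponent 2) ((ξ : ℤ_[2]ˣ) : ℤ_[2]) *
              (cyclotomicGenerator 2 : ZMod (2 ^ (n + cyclotomicExponent 2))) ^ s'.val))‖ ≤ C * ((2 : ℕ) : ℝ)⁻¹ := by
    intro n s s'
    rw [orbitSum_half_eq hν n s, orbitSum_half_eq hν n s']
    exact_mod_cast hcongr n s s'
  have h := norm_limUnder_riemannSum_le_of_forall_norm_orbitSum_sub_le (distributionRiemannSum_spec ν) hdν hbν hcongr' k
  have h2 : PowerSeries.coeff k (distributionTransform μ) = 2 * PowerSeries.coeff k (distributionTransform ν) := by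
    rw [coeff_distributionTransform, coeff_distributionTransform]
    have ht := (tendsto_distributionRiemannSum hdν hbν k).const_mul (2 : ℚ_[2])
    rw [coeff_distributionTransform] at ht
    have hfun : (fun m ↦ 2 * distributionRiemannSum ν k m) = distributionRiemannSum μ k :=
      funext fun m ↦ (distributionRiemannSum_eq_two_mul_half hν heven k m).symm
    rw [hfun] at ht
    exact ht.limUnder_eq
  rw [h2, ← mul_assoc, inv_mul_cancel₀ two_ne_zero, one_mul, coeff_distributionTransform]
  exact_mod_cast h

end Abstract

/-! ## §4 Curve level: the crux's hypothesis `red G ≠ 0` from ONE half-odd value, and `red G = 0` from congruent values -/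

section Curve

variable {N : ℕ} [NeZero N] {f : CuspForm (Gamma0 N) 2} (W : WeierstrassCurve ℚ) [W.IsElliptic] [W.IsGloballyMinimal]

/-- **`μ^an = 0` at `2` from ONE half-odd value of the Mazur–Swinnerton-Dyer measure.** `W` good ordinary at `2`, `E(ℚ)[2] = 0`, `f` its
newform, `G` an even-branch lift: if some `μ_{f,α}(5^{s₀} + 2^{n+2}ℤ₂) = α^{−(n+2)}[5^{s₀}/2^{n+2}]⁺ − α^{−(n+3)}[5^{s₀}/2^{n+1}]⁺` has norm `> 1`
(a genuine half-integer), then `red G ≠ 0` — the crux's hypothesis `μ^an(W) = 0`; a kernel display format for the census's «`μ = 0`» rows.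
[cite: MazurTateTeitelbaum1986Invent, §I.10 (10.1), §I.11–I.13] [cite: GreenbergVatsal2000, p. 2 (2)–(3)] -/
theorem red_ne_zero_of_half_odd_msdMeasure (hord : IsOrdinaryAt W 2) (ht : ∀ x : ℚ, ¬ HasRationalTwoTorsionX W x)
    (hf : IsNewformOf W f) {n : ℕ} {s₀ : ZMod (2 ^ n)}
    (hs₀ : 1 < ‖msdMeasure f (unitRoot W 2 : ℚ_[2]) (n + 2) ((cyclotomicGenerator 2 : ZMod (2 ^ (n + 2))) ^ s₀.val)‖)
    {G : IwasawaAlgebra 2} (hG : IsEvenBranchLiftAtTwo W f G) : red G ≠ 0 := by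
  have hι := iwasawaToPowerSeries_eq_of_isEvenBranchLiftAtTwo_of_isOrdinaryAt W hord hG
  have hirr := AlignedTransportAtTwoClosure.irr_two_of_forall_not_hasRationalTwoTorsionX W ht
  obtain ⟨n₀, h2n₀, h0⟩ := exists_intCast_mul_modularSymbol_zero_mem (p := 2) not_irreducible_of_frobeniusTrace_congr_holds hf hirr
  have hdist := msdMeasure_distribution_of_isNewformOf hord hf
  have hC := norm_msdMeasure_two_le_two hord hf h2n₀ h0
  have hs₀' : (2 : ℝ) * (2 : ℝ)⁻¹ < ‖msdMeasure f (unitRoot W 2 : ℚ_[2]) (n + 2) ((cyclotomicGenerator 2 : ZMod (2 ^ (n + 2))) ^ s₀.val)‖ := by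
    norm_num; exact hs₀
  obtain ⟨k, -, hk⟩ := exists_lt_norm_coeff_of_lt_norm_apply_two (msdMeasure_neg f (unitRoot W 2 : ℚ_[2])) hdist hC hs₀'
  have norm_two : ‖(2 : ℚ_[2])‖ = (2 : ℝ)⁻¹ := by simpa using Padic.norm_p (p := 2)
  rw [← padicLFunction_eq_distributionTransform, ← hι, PowerSeries.coeff_map, PadicInt.algebraMap_apply, norm_mul, norm_inv,
    norm_two, inv_inv, PadicInt.padic_norm_e_of_padicInt] at hk
  -- `‖coeff k G‖ > ½`, so the coefficient is a unit of `ℤ₂` and `red G ≠ 0`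
  intro hred
  have hcoeff : PowerSeries.coeff k (red G) = 0 := by rw [hred, map_zero]
  rw [PowerSeries.coeff_map, IsLocalRing.residue_eq_zero_iff, IsLocalRing.mem_maximalIdeal, PadicInt.mem_nonunits] at hcoeff
  have hle : ‖(PowerSeries.coeff k G : ℤ_[2])‖ ≤ 2⁻¹ := norm_le_half_of_norm_lt_one hcoeff
  norm_num at hk; linarith

/-- **`μ^an > 0` at `2` from congruent values.** If at every level the values `μ_{f,α}(5ˢ + 2^{n+2}ℤ₂)` are congruent to one another modulo `ℤ₂`
(all `‖μ(5ˢ) − μ(5^{s'})‖ ≤ 1`), then `red G = 0` — the curve violates the crux's hypothesis `μ^an(W) = 0` (in the tree's normalisation).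
[cite: MazurTateTeitelbaum1986Invent, §I.11–I.13] -/
theorem red_eq_zero_of_msdMeasure_congr (hord : IsOrdinaryAt W 2) (ht : ∀ x : ℚ, ¬ HasRationalTwoTorsionX W x) (hf : IsNewformOf W f)
    (hcongr : ∀ (n : ℕ) (s s' : ZMod (2 ^ n)),
      ‖msdMeasure f (unitRoot W 2 : ℚ_[2]) (n + 2) ((cyclotomicGenerator 2 : ZMod (2 ^ (n + 2))) ^ s.val) -
          msdMeasure f (unitRoot W 2 : ℚ_[2]) (n + 2) ((cyclotomicGenerator 2 : ZMod (2 ^ (n + 2))) ^ s'.val)‖ ≤ 1)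
    {G : IwasawaAlgebra 2} (hG : IsEvenBranchLiftAtTwo W f G) : red G = 0 := by
  have hι := iwasawaToPowerSeries_eq_of_isEvenBranchLiftAtTwo_of_isOrdinaryAt W hord hG
  have hirr := AlignedTransportAtTwoClosure.irr_two_of_forall_not_hasRationalTwoTorsionX W ht
  obtain ⟨n₀, h2n₀, h0⟩ := exists_intCast_mul_modularSymbol_zero_mem (p := 2) not_irreducible_of_frobeniusTrace_congr_holds hf hirr
  have hdist := msdMeasure_distribution_of_isNewformOf hord hf
  have hC := norm_msdMeasure_two_le_two hord hf h2n₀ h0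
  have hcongr' : ∀ (n : ℕ) (s s' : ZMod (2 ^ n)),
      ‖msdMeasure f (unitRoot W 2 : ℚ_[2]) (n + 2) ((cyclotomicGenerator 2 : ZMod (2 ^ (n + 2))) ^ s.val) -
          msdMeasure f (unitRoot W 2 : ℚ_[2]) (n + 2) ((cyclotomicGenerator 2 : ZMod (2 ^ (n + 2))) ^ s'.val)‖ ≤ 2 * (2 : ℝ)⁻¹ := by
    norm_num; exact hcongr
  refine (red_eq_of_norm_coeff_sub_le_half (G₂ := 0) fun k ↦ ?_).trans (map_zero _)
  have norm_two : ‖(2 : ℚ_[2])‖ = (2 : ℝ)⁻¹ := by simpa using Padic.norm_p (p := 2)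
  have h := norm_coeff_le_of_forall_norm_sub_le_two (msdMeasure_neg f (unitRoot W 2 : ℚ_[2])) hdist hC hcongr' k
  rw [← padicLFunction_eq_distributionTransform, ← hι, norm_mul, norm_inv, norm_two, inv_inv] at h
  rw [map_zero, map_zero, sub_zero]
  norm_num at h ⊢; linarith
end Curve

end Summit.BirchSwinnertonDyer.BirchSwinnertonDyer.Theorems.AlignedTransportAtTwoMuCertificate

end
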